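import Mathlib.Analysis.Fourier.LpSpace
import Mathlib.Analysis.Distribution.AEEqOfIntegralContDiff
import Mathlib.MeasureTheory.Integral.IntegralEqImproper
import Mathlib.MeasureTheory.Function.LocallyIntegrable
import HarnessLib

/-!
# The `L²` Fourier transform of a derivative: `𝓕(u') = 2πiξ · 𝓕(u)` for `u, u' ∈ L²(ℝ; F)`

Analysis/Fourier support file (theorem-only). For a `C¹` function `u : ℝ → F` (`F` a complex
Hilbert space) with `u, u' ∈ L²`, the `L²` Fourier transform (Mathlib's
`MeasureTheory.Lp.fourierTransformₗᵢ`, normalisation `𝓕f(ξ) = ∫ e^{-2πiξt} f(t) dt`) satisfies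
`𝓕[u'](ξ) = (2πiξ) 𝓕[u](ξ)` for a.e. `ξ` (`fourier_deriv_ae_eq`). This is the rule
"`∂_t ↦ -iω`" used to separate the time variable in wave equations (e.g.
Dafermos–Rodnianski–Shlapentokh-Rothman, arXiv:1402.7034, §5.2.2, with `ω = -2πξ`), for functions
that are square integrable in time but not necessarily integrable.

Proof: in tempered distributions, `T_{u'} = ∂ T_u` (integration by parts against Schwartz
functions, `derivCLM_toTemperedDistribution_toLp`), `𝓕 ∂ = (2πiξ)· 𝓕`
(`TemperedDistribution.fourier_lineDerivOp_eq`) and `𝓕 T_f = T_{𝓕 f}` for `f ∈ L²`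
(`MeasureTheory.Lp.fourier_toTemperedDistribution_eq`); two locally integrable functions
inducing the same distribution agree a.e. (`ae_eq_zero_of_integral_contDiff_smul_eq_zero`).

## Mathlib search

All ingredients are Mathlib's (listed above); the `L²` statement itself is absent (searched
`fourier.*deriv`, `fourierIntegral_deriv` — the latter is the `L¹` Fourier *integral* version
`Real.fourierIntegral_deriv`, which needs `u, u' ∈ L¹`).

## References

* M. Dafermos, I. Rodnianski, Y. Shlapentokh-Rothman, arXiv:1402.7034, §5.2.2.
  [DafermosRodnianskiShlapentokhrothman2014]
-/

noncomputable section

open MeasureTheory SchwartzMap TemperedDistribution Real Set Filter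
open scoped FourierTransform LineDeriv Topology ENNReal

namespace Literature.Analysis.Fourier

variable {F : Type*} [NormedAddCommGroup F] [InnerProductSpace ℂ F] [CompleteSpace F]

omit [CompleteSpace F] in
/-- The product of a Schwartz function and an `L²` function is integrable. [folklore] -/
theorem integrable_schwartz_smul_of_memLp (g : 𝓢(ℝ, ℂ)) {u : ℝ → F} (hu : MemLp u 2 volume) :
    Integrable (fun x ↦ g x • u x) := by
  have hg : MemLp (g : ℝ → ℂ) 2 volume := g.memLp 2 volume
  have h : MemLp ((g : ℝ → ℂ) • u) 1 volume := MemLp.smul (r := 1) hu hg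
  exact memLp_one_iff_integrable.1 h

/-- **`T_{u'} = ∂ T_u`**: for `u ∈ C¹` with `u, u' ∈ L²`, the distributional derivative of the
tempered distribution of `u` is the tempered distribution of `u'` (integration by parts).
[folklore] -/
theorem derivCLM_toTemperedDistribution_toLp {u u' : ℝ → F} (hu : ∀ t, HasDerivAt u (u' t) t)
    (hmu : MemLp u 2 volume) (hmu' : MemLp u' 2 volume) :
    derivCLM F (Lp.toTemperedDistribution (hmu.toLp u)) =
      Lp.toTemperedDistribution (hmu'.toLp u') := by
  ext g
  rw [derivCLM_apply_apply, Lp.toTemperedDistribution_apply, Lp.toTemperedDistribution_apply]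
  have h1 : ∫ x, (-(SchwartzMap.derivCLM ℂ ℂ g)) x • (hmu.toLp u) x = -∫ x, deriv g x • u x := by
    rw [← integral_neg]
    refine integral_congr_ae ?_
    filter_upwards [hmu.coeFn_toLp] with x hx
    rw [hx, neg_apply, SchwartzMap.derivCLM_apply, neg_smul]
  have h2 : ∫ x, g x • (hmu'.toLp u') x = ∫ x, g x • u' x := by
    refine integral_congr_ae ?_
    filter_upwards [hmu'.coeFn_toLp] with x hx
    rw [hx]
  rw [h1, h2]
  have hIBP := integral_bilinear_hasDerivAt_right_eq_neg_left_of_integrable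
    (L := (ContinuousLinearMap.lsmul ℝ ℂ : ℂ →L[ℝ] F →L[ℝ] F).flip) (u := u) (u' := u')
    (v := (g : ℝ → ℂ)) (v' := deriv g) (fun x _ ↦ hu x)
    (fun x _ ↦ g.differentiableAt.hasDerivAt) ?_ ?_ ?_
  · simp only [ContinuousLinearMap.flip_apply, ContinuousLinearMap.lsmul_apply] at hIBP
    rw [hIBP, neg_neg]
  · have := integrable_schwartz_smul_of_memLp (SchwartzMap.derivCLM ℂ ℂ g) hmu
    simpa only [ContinuousLinearMap.flip_apply, ContinuousLinearMap.lsmul_apply,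
      SchwartzMap.derivCLM_apply] using this
  · simpa only [ContinuousLinearMap.flip_apply, ContinuousLinearMap.lsmul_apply] using
      integrable_schwartz_smul_of_memLp g hmu'
  · simpa only [ContinuousLinearMap.flip_apply, ContinuousLinearMap.lsmul_apply] using
      integrable_schwartz_smul_of_memLp g hmu

omit [CompleteSpace F] in
/-- The one-dimensional derivative of tempered distributions is the line derivative in the
direction `1`. [folklore] -/
theorem derivCLM_eq_lineDerivOp (T : 𝓢'(ℝ, F)) : derivCLM F T = ∂_{(1 : ℝ)} T := by
  ext g
  rw [derivCLM_apply_apply, lineDerivOp_apply_apply]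
  congr 2

/-- **`𝓕(u') = 2πiξ · 𝓕(u)` in `L²(ℝ; F)`.** For `u ∈ C¹` with `u, u' ∈ L²`, the `L²` Fourier
transforms satisfy `𝓕[u'](ξ) = (2πiξ) • 𝓕[u](ξ)` for a.e. `ξ`.
[cite: DafermosRodnianskiShlapentokhrothman2014, §5.2.2] -/
theorem fourier_deriv_ae_eq {u u' : ℝ → F} (hu : ∀ t, HasDerivAt u (u' t) t)
    (hmu : MemLp u 2 volume) (hmu' : MemLp u' 2 volume) :
    ((𝓕 (hmu'.toLp u') : Lp F 2 (volume : Measure ℝ)) : ℝ → F) =ᵐ[volume]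
      fun ξ ↦ ((2 * π * Complex.I) * ξ : ℂ) • (𝓕 (hmu.toLp u) : Lp F 2 (volume : Measure ℝ)) ξ := by
  -- the distributional identity
  have hT : Lp.toTemperedDistribution (𝓕 (hmu'.toLp u') : Lp F 2 (volume : Measure ℝ)) =
      (2 * π * Complex.I) • smulLeftCLM F (fun x : ℝ ↦ ((inner ℝ x (1 : ℝ) : ℝ) : ℂ))
        (Lp.toTemperedDistribution (𝓕 (hmu.toLp u) : Lp F 2 (volume : Measure ℝ))) := by
    rw [← Lp.fourier_toTemperedDistribution_eq, ← Lp.fourier_toTemperedDistribution_eq,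
      ← derivCLM_toTemperedDistribution_toLp hu hmu hmu', derivCLM_eq_lineDerivOp,
      TemperedDistribution.fourier_lineDerivOp_eq]
  -- abbreviations
  set W : ℝ → F := ((𝓕 (hmu'.toLp u') : Lp F 2 (volume : Measure ℝ)) : ℝ → F) with hW
  set Z : ℝ → F := ((𝓕 (hmu.toLp u) : Lp F 2 (volume : Measure ℝ)) : ℝ → F) with hZ
  have hWmem : MemLp W 2 volume := Lp.memLp _
  have hZmem : MemLp Z 2 volume := Lp.memLp _
  have htg : (fun x : ℝ ↦ ((inner ℝ x (1 : ℝ) : ℝ) : ℂ)).HasTemperateGrowth := by fun_prop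
  -- test against Schwartz functions
  have htest : ∀ φ : 𝓢(ℝ, ℂ),
      ∫ x, φ x • W x = ∫ x, φ x • (((2 * π * Complex.I) * x : ℂ) • Z x) := by
    intro φ
    have h1 : Lp.toTemperedDistribution (𝓕 (hmu'.toLp u') : Lp F 2 (volume : Measure ℝ)) φ =
        ∫ x, φ x • W x := Lp.toTemperedDistribution_apply _ _
    rw [← h1, hT, _root_.smul_apply, TemperedDistribution.smulLeftCLM_apply_apply,
      Lp.toTemperedDistribution_apply, ← integral_smul]
    refine integral_congr_ae (ae_of_all _ fun x ↦ ?_)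
    dsimp only
    rw [SchwartzMap.smulLeftCLM_apply_apply htg, smul_smul, smul_smul]
    congr 1
    have hin : inner ℝ x (1 : ℝ) = x := by simp
    rw [hin, smul_eq_mul]
    ring
  -- the difference is locally integrable and kills all test functions
  set f : ℝ → F := fun x ↦ W x - (((2 * π * Complex.I) * x : ℂ) • Z x) with hf
  have hZloc : LocallyIntegrable (fun x : ℝ ↦ ((2 * π * Complex.I) * x : ℂ) • Z x) volume := by
    have hZ' : LocallyIntegrableOn Z univ volume :=
      (locallyIntegrableOn_univ).2 (hZmem.locallyIntegrable one_le_two)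
    have hc : ContinuousOn (fun x : ℝ ↦ ((2 * π * Complex.I) * x : ℂ)) univ := by fun_prop
    exact (locallyIntegrableOn_univ).1 (hZ'.continuousOn_smul isOpen_univ.isLocallyClosed hc)
  have hfloc : LocallyIntegrable f volume :=
    (hWmem.locallyIntegrable one_le_two).sub hZloc
  have hzero : ∀ᵐ x ∂volume, f x = 0 := by
    refine ae_eq_zero_of_integral_contDiff_smul_eq_zero hfloc fun g hg hgs ↦ ?_
    -- the complexified test function as a Schwartz map
    have hgc : ContDiff ℝ (⊤ : ℕ∞) fun x ↦ (g x : ℂ) := Complex.ofRealCLM.contDiff.comp hg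
    have hgcs : HasCompactSupport fun x ↦ (g x : ℂ) := hgs.comp_left Complex.ofReal_zero
    set φ : 𝓢(ℝ, ℂ) := hgcs.toSchwartzMap hgc with hφ
    have hφ_apply : ∀ x, φ x = (g x : ℂ) := fun x ↦ rfl
    have hint1 : Integrable fun x ↦ φ x • W x := integrable_schwartz_smul_of_memLp φ hWmem
    have hφcs : HasCompactSupport (φ : ℝ → ℂ) := by
      have : (φ : ℝ → ℂ) = fun x ↦ (g x : ℂ) := funext hφ_apply
      rw [this]
      exact hgcs
    have hint2 : Integrable fun x ↦ φ x • (((2 * π * Complex.I) * x : ℂ) • Z x) :=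
      hZloc.integrable_smul_left_of_hasCompactSupport φ.continuous hφcs
    calc ∫ x, g x • f x = ∫ x, (φ x • W x - φ x • (((2 * π * Complex.I) * x : ℂ) • Z x)) := by
          refine integral_congr_ae (ae_of_all _ fun x ↦ ?_)
          simp only [hf, hφ_apply, ← smul_sub, Complex.coe_smul]
      _ = 0 := by rw [integral_sub hint1 hint2, htest φ, sub_self]
  filter_upwards [hzero] with x hx
  rwa [hf, sub_eq_zero] at hx

end Literature.Analysis.Fourier
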